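import Summits.Parity.GeneralizedHardyLittlewood.Theorems.BeyondDiagonalBeatsQuarter.PeterssonSplit
import Summits.Parity.GeneralizedHardyLittlewood.Theorems.PrimeLevelFamEdgeMomentsBeyondDiagonalDictionaryAtOneBoxError
import Literature.NumberTheory.LFunctions.KowalskiMichelPeterssonBoundWeilFree
import Literature.NumberTheory.Sieve.DivisorBound
import HarnessLib

/-!
# Route `PrimeLevelFamEdge`, crux K_B (stmt-Parity-20343), line `diagonal_kernel_split` rev 4, plan Ω,
# step Ω-d3 `OffDiagLayers` (part 1 of 2): the explicit off-diagonal `PeterssonSplit.offDiag` term by term in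
# `((n₁,n₂), r)` — the Petersson LAYERS `c = q·r`, their Weil majorant, JOINT absolute convergence

The rev-4 heart `stub_offDiagBelowSlack_io` is a statement about
`OFF_q(l,m) = offDiag q l m = 2q̂ Σ_{(n₁,n₂)} w_q(n₁,n₂) Σ_{d₁∣(l,n₁)} Σ_{d₂∣(m,n₂)} J_q(l n₁/d₁², m n₂/d₂²)`,
`J_q(a,b) = (2π/q) Σ_{r≥1} r⁻¹ S(a,b;qr) J₁(4π√(ab)/(qr))` (`KowalskiMichel2000.petJ`). Plan Ω-d opens the
Kloosterman sums LAYER BY LAYER (modulus `c = qr`); this file and `OffDiagLayersTail.lean` are the bookkeeping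
that makes the layers available (pattern: the K_A lead's `…DictionaryAtOneBounds` §2 / `…Truncation` §2, same
`petJ`). Here:
* the summand `offDiagTerm q l m n r = w_q(n)·Σ_{d₁,d₂} r⁻¹S(a,b;qr)J₁(…)`, the layer
  `offDiagLayer q l m r = Σ_n offDiagTerm q l m n r`, and the pair size `offDiagPairSize l m n = Σ_{d₁,d₂} √(a,b)√(ab)`;
* Weil's bound (the tree's theorem, through `PeterssonLayers.norm_petKloostermanTerm_le_rpow`:
  `|r⁻¹S(a,b;qr)J₁| ≤ 4πC√(a,b)√(ab) q^{−1/2} r^{−29/20}`) and KMV's cut-off decay `W(y) ≤ 2·3!·y^{−3/2}` give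
  `‖offDiagTerm q l m n r‖ ≤ w_q(n)·offDiagPairSize l m n·4πC q^{−1/2} r^{−29/20}
  ≤ [12 q̂³ τ(l)τ(m)(lm)^{3/4}·4πC q^{−1/2}] · n₁^{−5/4} n₂^{−5/4} · r^{−29/20}` (`norm_offDiagTerm_le(_majorant)`);
* hence the family `((n₁,n₂), r) ↦ offDiagTerm` is SUMMABLE on `(ℕ × ℕ) × ℕ` (`summable_offDiagTerm`), with both
  sections and the layer series `Σ_r offDiagLayer` absolutely convergent (`summable_offDiagLayer`).
Part 2 (`OffDiagLayersTail.lean`): Fubini `offDiag = 2q̂(2π/q)Σ_r offDiagLayer`, divisor re-indexing `nᵢ = dᵢkᵢ`,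
and the explicit `r`-tail. Absolute-value bounds at a FIXED prime level only: no cancellation, no asymptotic,
nothing about the heart. Helper (`--supports stmt-Parity-20343`); standard axioms.
«The programme SEARCHES and TYPES; no claim about Landau–Siegel zeros, Theorems 1–2 of arXiv:2211.02515 or
a repaired Margin232 until a kernel theorem says so.»
-/

noncomputable section

open Finset
open scoped Real Nat

namespace Summit.Parity.GeneralizedHardyLittlewood.Theorems.BeyondDiagonalBeatsQuarter.PeterssonSplit

open Literature.NumberTheory.LFunctions Literature.NumberTheory.LFunctions.KMV2000
open Literature.NumberTheory.LFunctions.KowalskiMichel2000 (petKloostermanTerm petKloostermanTerm_zero)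
open Summit.Parity.GeneralizedHardyLittlewood.Theorems.PrimeLevelFamEdgeIdeaDeltas.PeterssonLayers
  (norm_petKloostermanTerm_le_rpow cutoffW_le_factorial_mul_rpow sqrt_gcd_mul_sqrt_le card_divisors_gcd_le
    summable_prod_rpow one_le_mul_div_sq)

variable {q : ℕ} [NeZero q]

/-! ### §1. The layer summand, the layer, the pair size -/

/-- The summand of `offDiag q l m` at AFE index `n = (n₁,n₂)` and Petersson modulus `c = q·r`:
`w_q(n₁,n₂) · Σ_{d₁∣(l,n₁)} Σ_{d₂∣(m,n₂)} r⁻¹ S(a,b;qr) J₁(4π√(ab)/(qr))`, `a = l n₁/d₁²`, `b = m n₂/d₂²`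
(`= 0` at `r = 0` and on the axes `n₁n₂ = 0`). A bookkeeping abbreviation of this line.
[cite: KowalskiMichelVanderKam2000, (21)–(23) p. 12 and Lemma 3.3 p. 9; KowalskiMichel2000, §2.4.2 p. 312 — derivation] -/
def offDiagTerm (q : ℕ) [NeZero q] (l m : ℕ) (n : ℕ × ℕ) (r : ℕ) : ℂ :=
  (afeWeight q n : ℂ) * ∑ d₁ ∈ (l.gcd n.1).divisors, ∑ d₂ ∈ (m.gcd n.2).divisors,
    petKloostermanTerm q (l * n.1 / d₁ ^ 2) (m * n.2 / d₂ ^ 2) r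

/-- **The layer of Petersson modulus `c = q·r`** of the off-diagonal: `offDiagLayer q l m r := Σ_{(n₁,n₂)}
offDiagTerm q l m (n₁,n₂) r` (absolutely convergent, `summable_offDiagTerm_right`), so that
`offDiag q l m = 2q̂·(2π/q)·Σ_{r ≥ 1} offDiagLayer q l m r` (`offDiag_eq_tsum_offDiagLayer`, part 2).
[cite: KowalskiMichelVanderKam2000, (21)–(23) p. 12 and Lemma 3.3 p. 9; KowalskiMichel2000, §2.4.2 p. 312 — derivation] -/
def offDiagLayer (q : ℕ) [NeZero q] (l m r : ℕ) : ℂ :=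
  ∑' n : ℕ × ℕ, offDiagTerm q l m n r

/-- The size attached to the pair `(l, m)` at AFE index `n` in the layer bounds:
`offDiagPairSize l m n := Σ_{d₁∣(l,n₁)} Σ_{d₂∣(m,n₂)} √(a,b)·√(ab)`, `a = l n₁/d₁²`, `b = m n₂/d₂²`
(the `(a,b)`-dependence of Weil's bound `|S(a,b;c)| ≤ (a,b,c)^{1/2} c^{1/2} τ(c)` times `|J₁(x)| ≤ x/2`).
[cite: KowalskiMichel2000, §2.4.2 p. 312 (23) — derivation] -/
def offDiagPairSize (l m : ℕ) (n : ℕ × ℕ) : ℝ :=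
  ∑ d₁ ∈ (l.gcd n.1).divisors, ∑ d₂ ∈ (m.gcd n.2).divisors,
    Real.sqrt (((l * n.1 / d₁ ^ 2).gcd (m * n.2 / d₂ ^ 2) : ℕ) : ℝ) *
      Real.sqrt (((l * n.1 / d₁ ^ 2 : ℕ) : ℝ) * ((m * n.2 / d₂ ^ 2 : ℕ) : ℝ))

omit [NeZero q] in
/-- The AFE weight vanishes on the axis `n₁ = 0`. [cite: KowalskiMichelVanderKam2000, (21) p. 12] -/
theorem afeWeight_eq_zero_of_fst {n : ℕ × ℕ} (h : n.1 = 0) : afeWeight q n = 0 := by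
  simp [afeWeight, h]

omit [NeZero q] in
/-- The AFE weight vanishes on the axis `n₂ = 0`. [cite: KowalskiMichelVanderKam2000, (21) p. 12] -/
theorem afeWeight_eq_zero_of_snd {n : ℕ × ℕ} (h : n.2 = 0) : afeWeight q n = 0 := by
  simp [afeWeight, h]

/-- The layer summand vanishes at `r = 0` (indexing convention of `Σ_{r ≥ 1}`).
[cite: KowalskiMichel2000, §2.4.2 p. 312 (definition of J)] -/
@[simp] theorem offDiagTerm_zero (l m : ℕ) (n : ℕ × ℕ) : offDiagTerm q l m n 0 = 0 := by
  simp [offDiagTerm]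

/-- The layer summand vanishes on the axes `n₁ n₂ = 0`. [cite: KowalskiMichelVanderKam2000, (21) p. 12] -/
theorem offDiagTerm_eq_zero_of_axes {l m : ℕ} {n : ℕ × ℕ} (h : n.1 = 0 ∨ n.2 = 0) (r : ℕ) :
    offDiagTerm q l m n r = 0 := by
  rcases h with h | h
  · simp [offDiagTerm, afeWeight_eq_zero_of_fst h]
  · simp [offDiagTerm, afeWeight_eq_zero_of_snd h]

/-- The zeroth layer vanishes. [cite: KowalskiMichel2000, §2.4.2 p. 312 (definition of J)] -/
@[simp] theorem offDiagLayer_zero (l m : ℕ) : offDiagLayer q l m 0 = 0 := by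
  simp [offDiagLayer]

omit [NeZero q] in
/-- `offDiagPairSize ≥ 0`. [cite: KowalskiMichel2000, §2.4.2 p. 312 (23) — derivation] -/
theorem offDiagPairSize_nonneg (l m : ℕ) (n : ℕ × ℕ) : 0 ≤ offDiagPairSize l m n :=
  Finset.sum_nonneg fun _ _ ↦ Finset.sum_nonneg fun _ _ ↦ by positivity

omit [NeZero q] in
/-- One Weil factor is polynomial: `√(a,b)·√(ab) ≤ (l m n₁ n₂)^{3/4}` for `a = l n₁/d₁²`, `b = m n₂/d₂²`,
`d₁ ∣ (l,n₁)`, `d₂ ∣ (m,n₂)`, all of `l, m, n₁, n₂ ≥ 1` (`(a,b)² ≤ ab`, `a ≤ l n₁`, `b ≤ m n₂`).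
[cite: KowalskiMichel2000, §2.4.2 p. 312 (23) — derivation] -/
theorem sqrt_gcd_mul_sqrt_le_rpow {l m : ℕ} (hl : 1 ≤ l) (hm : 1 ≤ m) {n : ℕ × ℕ} (h1 : 1 ≤ n.1)
    (h2 : 1 ≤ n.2) {d₁ d₂ : ℕ} (hd₁ : d₁ ∈ (l.gcd n.1).divisors) (hd₂ : d₂ ∈ (m.gcd n.2).divisors) :
    Real.sqrt (((l * n.1 / d₁ ^ 2).gcd (m * n.2 / d₂ ^ 2) : ℕ) : ℝ) *
        Real.sqrt (((l * n.1 / d₁ ^ 2 : ℕ) : ℝ) * ((m * n.2 / d₂ ^ 2 : ℕ) : ℝ)) ≤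
      (((l : ℝ) * m) * ((n.1 : ℝ) * n.2)) ^ (3 / 4 : ℝ) := by
  have ha := one_le_mul_div_sq hd₁ hl h1
  have hb := one_le_mul_div_sq hd₂ hm h2
  refine (sqrt_gcd_mul_sqrt_le ha hb).trans (Real.rpow_le_rpow (by positivity) ?_ (by norm_num))
  have h₁ : ((l * n.1 / d₁ ^ 2 : ℕ) : ℝ) ≤ (l : ℝ) * n.1 := by exact_mod_cast Nat.div_le_self _ _
  have h₂ : ((m * n.2 / d₂ ^ 2 : ℕ) : ℝ) ≤ (m : ℝ) * n.2 := by exact_mod_cast Nat.div_le_self _ _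
  calc ((l * n.1 / d₁ ^ 2 : ℕ) : ℝ) * ((m * n.2 / d₂ ^ 2 : ℕ) : ℝ)
      ≤ ((l : ℝ) * n.1) * ((m : ℝ) * n.2) := mul_le_mul h₁ h₂ (by positivity) (by positivity)
    _ = ((l : ℝ) * m) * ((n.1 : ℝ) * n.2) := by ring

omit [NeZero q] in
/-- **The pair size is polynomial**: for `l, m, n₁, n₂ ≥ 1`,
`offDiagPairSize l m n ≤ τ(l)·τ(m)·(l m n₁ n₂)^{3/4}` (`τ((l,n₁)) ≤ τ(l)`).
[cite: KowalskiMichel2000, §2.4.2 p. 312 (23) — derivation] -/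
theorem offDiagPairSize_le {l m : ℕ} (hl : 1 ≤ l) (hm : 1 ≤ m) {n : ℕ × ℕ} (h1 : 1 ≤ n.1) (h2 : 1 ≤ n.2) :
    offDiagPairSize l m n ≤
      (l.divisors.card : ℝ) * (m.divisors.card : ℝ) * (((l : ℝ) * m) * ((n.1 : ℝ) * n.2)) ^ (3 / 4 : ℝ) := by
  have hX : 0 ≤ (((l : ℝ) * m) * ((n.1 : ℝ) * n.2)) ^ (3 / 4 : ℝ) := by positivity
  unfold offDiagPairSize
  calc ∑ d₁ ∈ (l.gcd n.1).divisors, ∑ d₂ ∈ (m.gcd n.2).divisors,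
        Real.sqrt (((l * n.1 / d₁ ^ 2).gcd (m * n.2 / d₂ ^ 2) : ℕ) : ℝ) *
          Real.sqrt (((l * n.1 / d₁ ^ 2 : ℕ) : ℝ) * ((m * n.2 / d₂ ^ 2 : ℕ) : ℝ))
      ≤ ∑ d₁ ∈ (l.gcd n.1).divisors, ∑ d₂ ∈ (m.gcd n.2).divisors,
          (((l : ℝ) * m) * ((n.1 : ℝ) * n.2)) ^ (3 / 4 : ℝ) :=
        Finset.sum_le_sum fun d₁ hd₁ ↦ Finset.sum_le_sum fun d₂ hd₂ ↦
          sqrt_gcd_mul_sqrt_le_rpow hl hm h1 h2 hd₁ hd₂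
    _ = ((l.gcd n.1).divisors.card : ℝ) * (((m.gcd n.2).divisors.card : ℝ) *
          (((l : ℝ) * m) * ((n.1 : ℝ) * n.2)) ^ (3 / 4 : ℝ)) := by
        rw [Finset.sum_const, nsmul_eq_mul, Finset.sum_const, nsmul_eq_mul]
    _ ≤ (l.divisors.card : ℝ) * ((m.divisors.card : ℝ) *
          (((l : ℝ) * m) * ((n.1 : ℝ) * n.2)) ^ (3 / 4 : ℝ)) := by
        have hc₁ : ((l.gcd n.1).divisors.card : ℝ) ≤ l.divisors.card := by
          exact_mod_cast card_divisors_gcd_le hl n.1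
        have hc₂ : ((m.gcd n.2).divisors.card : ℝ) ≤ m.divisors.card := by
          exact_mod_cast card_divisors_gcd_le hm n.2
        exact mul_le_mul hc₁ (mul_le_mul_of_nonneg_right hc₂ hX) (by positivity) (by positivity)
    _ = _ := by ring

omit [NeZero q] in
/-- **The AFE weight against `(n₁n₂)^{3/4}`**: `w_q(n₁,n₂)·(n₁n₂)^{3/4} ≤ 12 q̂³ · n₁^{−5/4} n₂^{−5/4}` for `q ≥ 1`
(`W(y) ≤ 2·3!·y^{−3/2}`; `0 ≤ 0` on the axes). [cite: KowalskiMichelVanderKam2000, (22) p. 12 — derivation] -/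
theorem afeWeight_mul_rpow_le (hq : 1 ≤ q) (n : ℕ × ℕ) :
    afeWeight q n * ((n.1 : ℝ) * n.2) ^ (3 / 4 : ℝ) ≤
      12 * qhat q ^ 3 * ((n.1 : ℝ) ^ (-(5 / 4 : ℝ)) * (n.2 : ℝ) ^ (-(5 / 4 : ℝ))) := by
  have hQ : 0 < qhat q := qhat_pos hq
  rcases Nat.eq_zero_or_pos n.1 with h1 | h1
  · rw [afeWeight_eq_zero_of_fst h1, zero_mul]; positivity
  rcases Nat.eq_zero_or_pos n.2 with h2 | h2
  · rw [afeWeight_eq_zero_of_snd h2, zero_mul]; positivity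
  set x : ℝ := (n.1 : ℝ) * n.2 with hx_def
  have hx : 0 < x := by positivity
  have hy : 0 < x / qhat q ^ 2 := by positivity
  have hW : cutoffW (x / qhat q ^ 2) ≤ 12 * (x ^ (-(3 / 2 : ℝ)) * qhat q ^ 3) := by
    have h := cutoffW_le_factorial_mul_rpow hy 3
    have hQ3 : (qhat q ^ 2) ^ (-(3 / 2 : ℝ)) = (qhat q ^ 3)⁻¹ := by
      rw [← Real.rpow_natCast (qhat q) 2, ← Real.rpow_mul hQ.le,
        show ((2 : ℕ) : ℝ) * (-(3 / 2 : ℝ)) = -((3 : ℕ) : ℝ) by norm_num, Real.rpow_neg hQ.le,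
        Real.rpow_natCast]
    have e : (x / qhat q ^ 2) ^ (-(((3 : ℕ) : ℝ) / 2)) = x ^ (-(3 / 2 : ℝ)) * qhat q ^ 3 := by
      rw [show (-(((3 : ℕ) : ℝ) / 2)) = -(3 / 2 : ℝ) by norm_num, Real.div_rpow hx.le (by positivity), hQ3,
        div_inv_eq_mul]
    calc cutoffW (x / qhat q ^ 2) ≤ 2 * ((3 : ℕ)! : ℝ) * (x / qhat q ^ 2) ^ (-(((3 : ℕ) : ℝ) / 2)) := h
      _ = 12 * (x ^ (-(3 / 2 : ℝ)) * qhat q ^ 3) := by rw [e]; norm_num [Nat.factorial]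
  have hpow : x ^ (-(1 / 2 : ℝ)) * x ^ (-(3 / 2 : ℝ)) * x ^ (3 / 4 : ℝ) =
      (n.1 : ℝ) ^ (-(5 / 4 : ℝ)) * (n.2 : ℝ) ^ (-(5 / 4 : ℝ)) := by
    rw [← Real.rpow_add hx, ← Real.rpow_add hx, hx_def, ← Real.mul_rpow (by positivity) (by positivity)]
    norm_num
  unfold afeWeight
  rw [← hx_def]
  calc x ^ (-(1 / 2 : ℝ)) * cutoffW (x / qhat q ^ 2) * x ^ (3 / 4 : ℝ)
      ≤ x ^ (-(1 / 2 : ℝ)) * (12 * (x ^ (-(3 / 2 : ℝ)) * qhat q ^ 3)) * x ^ (3 / 4 : ℝ) := by gcongr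
    _ = 12 * qhat q ^ 3 * (x ^ (-(1 / 2 : ℝ)) * x ^ (-(3 / 2 : ℝ)) * x ^ (3 / 4 : ℝ)) := by ring
    _ = _ := by rw [hpow]

omit [NeZero q] in
/-- **The weighted pair size, termwise**: for `q, l, m ≥ 1` and every `n`,
`w_q(n)·offDiagPairSize l m n ≤ 12 q̂³ τ(l)τ(m)(lm)^{3/4} · n₁^{−5/4} n₂^{−5/4}`.
[cite: KowalskiMichel2000, §2.4.2 p. 312 (23); KowalskiMichelVanderKam2000, (22) p. 12 — derivation] -/
theorem afeWeight_mul_offDiagPairSize_le (hq : 1 ≤ q) {l m : ℕ} (hl : 1 ≤ l) (hm : 1 ≤ m) (n : ℕ × ℕ) :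
    afeWeight q n * offDiagPairSize l m n ≤
      12 * qhat q ^ 3 * ((l.divisors.card : ℝ) * (m.divisors.card : ℝ)) * ((l : ℝ) * m) ^ (3 / 4 : ℝ) *
        ((n.1 : ℝ) ^ (-(5 / 4 : ℝ)) * (n.2 : ℝ) ^ (-(5 / 4 : ℝ))) := by
  have hQ : 0 < qhat q := qhat_pos hq
  rcases Nat.eq_zero_or_pos n.1 with h1 | h1
  · rw [afeWeight_eq_zero_of_fst h1, zero_mul]; positivity
  rcases Nat.eq_zero_or_pos n.2 with h2 | h2
  · rw [afeWeight_eq_zero_of_snd h2, zero_mul]; positivity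
  have hw := afeWeight_nonneg q n
  have hsplit : (((l : ℝ) * m) * ((n.1 : ℝ) * n.2)) ^ (3 / 4 : ℝ) =
      ((l : ℝ) * m) ^ (3 / 4 : ℝ) * ((n.1 : ℝ) * n.2) ^ (3 / 4 : ℝ) :=
    Real.mul_rpow (by positivity) (by positivity)
  calc afeWeight q n * offDiagPairSize l m n
      ≤ afeWeight q n * ((l.divisors.card : ℝ) * (m.divisors.card : ℝ) *
          (((l : ℝ) * m) * ((n.1 : ℝ) * n.2)) ^ (3 / 4 : ℝ)) :=
        mul_le_mul_of_nonneg_left (offDiagPairSize_le hl hm h1 h2) hw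
    _ = ((l.divisors.card : ℝ) * (m.divisors.card : ℝ)) * ((l : ℝ) * m) ^ (3 / 4 : ℝ) *
          (afeWeight q n * ((n.1 : ℝ) * n.2) ^ (3 / 4 : ℝ)) := by rw [hsplit]; ring
    _ ≤ ((l.divisors.card : ℝ) * (m.divisors.card : ℝ)) * ((l : ℝ) * m) ^ (3 / 4 : ℝ) *
          (12 * qhat q ^ 3 * ((n.1 : ℝ) ^ (-(5 / 4 : ℝ)) * (n.2 : ℝ) ^ (-(5 / 4 : ℝ)))) :=
        mul_le_mul_of_nonneg_left (afeWeight_mul_rpow_le hq n) (by positivity)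
    _ = _ := by ring

/-! ### §2. Termwise Weil bound and JOINT absolute convergence in `((n₁,n₂), r)` -/

/-- **One `(d₁,d₂)`-piece of the layer summand** (Weil's bound — the tree's theorem — with
`((a,b),qr) ≤ (a,b)`, `τ(qr) ≤ 2τ(r) ≤ 2C r^{1/20}`, `|J₁(x)| ≤ x/2`): for `q` prime, `l ≥ 1`, `d₁ ∣ (l,n₁)`,
`‖w_q(n)·r⁻¹S(a,b;qr)J₁(4π√(ab)/(qr))‖ ≤ w_q(n)·√(a,b)√(ab)·4πC q^{−1/2} r^{−29/20}` (all `n`, `d₂`, `r`;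
`0 ≤ 0` where `w_q(n) = 0` or `r = 0`). [cite: KowalskiMichel2000, §2.4.2 p. 312 (23)] -/
theorem norm_afeWeight_mul_petKloostermanTerm_le (hq : q.Prime) {l : ℕ} (hl : 1 ≤ l) (m : ℕ) {C : ℝ}
    (hC : ∀ r : ℕ, ((r.divisors.card : ℕ) : ℝ) ≤ C * (r : ℝ) ^ (1 / 20 : ℝ)) (n : ℕ × ℕ)
    {d₁ : ℕ} (hd₁ : d₁ ∈ (l.gcd n.1).divisors) (d₂ : ℕ) (r : ℕ) :
    ‖(afeWeight q n : ℂ) * petKloostermanTerm q (l * n.1 / d₁ ^ 2) (m * n.2 / d₂ ^ 2) r‖ ≤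
      afeWeight q n * (Real.sqrt (((l * n.1 / d₁ ^ 2).gcd (m * n.2 / d₂ ^ 2) : ℕ) : ℝ) *
        Real.sqrt (((l * n.1 / d₁ ^ 2 : ℕ) : ℝ) * ((m * n.2 / d₂ ^ 2 : ℕ) : ℝ))) *
        (4 * π * C * (q : ℝ) ^ (-(1 / 2 : ℝ)) * (r : ℝ) ^ (-(29 / 20 : ℝ))) := by
  have hC0 : 0 ≤ C := by
    have h := hC 1
    simp at h
    linarith
  rcases Nat.eq_zero_or_pos n.1 with h1 | h1
  · rw [afeWeight_eq_zero_of_fst h1]; simp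
  rcases eq_or_ne r 0 with rfl | hr
  · simp [Real.zero_rpow (by norm_num : (-(29 / 20 : ℝ)) ≠ 0)]
  have ha := one_le_mul_div_sq hd₁ hl h1
  have hT := norm_petKloostermanTerm_le_rpow hq (b := m * n.2 / d₂ ^ 2) ha (ε := 1 / 20) hC r hr
  rw [show (-(3 / 2 - 1 / 20 : ℝ)) = -(29 / 20 : ℝ) by norm_num] at hT
  rw [norm_mul, Complex.norm_real, Real.norm_of_nonneg (afeWeight_nonneg q n)]
  calc afeWeight q n * ‖petKloostermanTerm q (l * n.1 / d₁ ^ 2) (m * n.2 / d₂ ^ 2) r‖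
      ≤ afeWeight q n * (4 * π * C * Real.sqrt (((l * n.1 / d₁ ^ 2).gcd (m * n.2 / d₂ ^ 2) : ℕ) : ℝ) *
          Real.sqrt (((l * n.1 / d₁ ^ 2 : ℕ) : ℝ) * ((m * n.2 / d₂ ^ 2 : ℕ) : ℝ)) *
          (q : ℝ) ^ (-(1 / 2 : ℝ)) * (r : ℝ) ^ (-(29 / 20 : ℝ))) :=
        mul_le_mul_of_nonneg_left hT (afeWeight_nonneg q n)
    _ = _ := by ring

/-- **The layer summand is bounded by the weighted pair size**: for `q` prime, `l ≥ 1`, a divisor bound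
`τ(r) ≤ C r^{1/20}` and all `n`, `r`: `‖offDiagTerm q l m n r‖ ≤ w_q(n)·offDiagPairSize l m n·4πC q^{−1/2} r^{−29/20}`.
[cite: KowalskiMichel2000, §2.4.2 p. 312 (23) — derivation] -/
theorem norm_offDiagTerm_le (hq : q.Prime) {l : ℕ} (hl : 1 ≤ l) (m : ℕ) {C : ℝ}
    (hC : ∀ r : ℕ, ((r.divisors.card : ℕ) : ℝ) ≤ C * (r : ℝ) ^ (1 / 20 : ℝ)) (n : ℕ × ℕ) (r : ℕ) :
    ‖offDiagTerm q l m n r‖ ≤ afeWeight q n * offDiagPairSize l m n *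
      (4 * π * C * (q : ℝ) ^ (-(1 / 2 : ℝ)) * (r : ℝ) ^ (-(29 / 20 : ℝ))) := by
  set K : ℝ := 4 * π * C * (q : ℝ) ^ (-(1 / 2 : ℝ)) * (r : ℝ) ^ (-(29 / 20 : ℝ)) with hK
  have hR : afeWeight q n * offDiagPairSize l m n * K =
      ∑ d₁ ∈ (l.gcd n.1).divisors, ∑ d₂ ∈ (m.gcd n.2).divisors,
        afeWeight q n * (Real.sqrt (((l * n.1 / d₁ ^ 2).gcd (m * n.2 / d₂ ^ 2) : ℕ) : ℝ) *
          Real.sqrt (((l * n.1 / d₁ ^ 2 : ℕ) : ℝ) * ((m * n.2 / d₂ ^ 2 : ℕ) : ℝ))) * K := by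
    unfold offDiagPairSize
    rw [Finset.mul_sum, Finset.sum_mul]
    refine Finset.sum_congr rfl fun d₁ _ ↦ ?_
    rw [Finset.mul_sum, Finset.sum_mul]
  rw [hR]
  unfold offDiagTerm
  rw [Finset.mul_sum]
  refine (norm_sum_le _ _).trans (Finset.sum_le_sum fun d₁ hd₁ ↦ ?_)
  rw [Finset.mul_sum]
  exact (norm_sum_le _ _).trans (Finset.sum_le_sum fun d₂ _ ↦
    norm_afeWeight_mul_petKloostermanTerm_le hq hl m hC n hd₁ d₂ r)

/-- **The joint majorant.** For `q` prime, `l, m ≥ 1`, all `n`, `r`: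
`‖offDiagTerm q l m n r‖ ≤ [12 q̂³ τ(l)τ(m)(lm)^{3/4}·4πC q^{−1/2}] · (n₁^{−5/4}n₂^{−5/4}) · r^{−29/20}`.
[cite: KowalskiMichel2000, §2.4.2 p. 312 (23); KowalskiMichelVanderKam2000, (22) p. 12 — derivation] -/
theorem norm_offDiagTerm_le_majorant (hq : q.Prime) {l m : ℕ} (hl : 1 ≤ l) (hm : 1 ≤ m) {C : ℝ}
    (hC : ∀ r : ℕ, ((r.divisors.card : ℕ) : ℝ) ≤ C * (r : ℝ) ^ (1 / 20 : ℝ)) (n : ℕ × ℕ) (r : ℕ) :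
    ‖offDiagTerm q l m n r‖ ≤
      (12 * qhat q ^ 3 * ((l.divisors.card : ℝ) * (m.divisors.card : ℝ)) * ((l : ℝ) * m) ^ (3 / 4 : ℝ) *
        (4 * π * C * (q : ℝ) ^ (-(1 / 2 : ℝ)))) *
      (((n.1 : ℝ) ^ (-(5 / 4 : ℝ)) * (n.2 : ℝ) ^ (-(5 / 4 : ℝ))) * (r : ℝ) ^ (-(29 / 20 : ℝ))) := by
  have hq1 : 1 ≤ q := hq.one_lt.le
  have hC0 : 0 ≤ C := by
    have h := hC 1
    simp at h
    linarith
  have hK : 0 ≤ 4 * π * C * (q : ℝ) ^ (-(1 / 2 : ℝ)) * (r : ℝ) ^ (-(29 / 20 : ℝ)) := by positivity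
  calc ‖offDiagTerm q l m n r‖
      ≤ afeWeight q n * offDiagPairSize l m n *
          (4 * π * C * (q : ℝ) ^ (-(1 / 2 : ℝ)) * (r : ℝ) ^ (-(29 / 20 : ℝ))) := norm_offDiagTerm_le hq hl m hC n r
    _ ≤ 12 * qhat q ^ 3 * ((l.divisors.card : ℝ) * (m.divisors.card : ℝ)) * ((l : ℝ) * m) ^ (3 / 4 : ℝ) *
          ((n.1 : ℝ) ^ (-(5 / 4 : ℝ)) * (n.2 : ℝ) ^ (-(5 / 4 : ℝ))) *
          (4 * π * C * (q : ℝ) ^ (-(1 / 2 : ℝ)) * (r : ℝ) ^ (-(29 / 20 : ℝ))) :=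
        mul_le_mul_of_nonneg_right (afeWeight_mul_offDiagPairSize_le hq1 hl hm n) hK
    _ = _ := by ring

/-- **JOINT absolute convergence of the off-diagonal in `((n₁,n₂), r)`** (`q` prime, `l, m ≥ 1`): the family
`((n₁,n₂), r) ↦ offDiagTerm q l m (n₁,n₂) r` is summable on `(ℕ × ℕ) × ℕ` (majorant
`n₁^{−5/4}n₂^{−5/4}r^{−29/20}`). [cite: KowalskiMichel2000, §2.4.2 p. 312 (23); KowalskiMichelVanderKam2000, (22) p. 12 — derivation] -/
theorem summable_offDiagTerm (hq : q.Prime) {l m : ℕ} (hl : 1 ≤ l) (hm : 1 ≤ m) :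
    Summable (Function.uncurry (offDiagTerm q l m)) := by
  obtain ⟨C, -, hC⟩ :=
    Literature.NumberTheory.Sieve.exists_card_divisors_le_mul_rpow' (by norm_num : (0 : ℝ) < 1 / 20)
  have hf := summable_prod_rpow (by norm_num : (1 : ℝ) < 5 / 4)
  have hg : Summable (fun r : ℕ ↦ (r : ℝ) ^ (-(29 / 20 : ℝ))) := Real.summable_nat_rpow.mpr (by norm_num)
  have hfg : Summable (fun p : (ℕ × ℕ) × ℕ ↦
      ((p.1.1 : ℝ) ^ (-(5 / 4 : ℝ)) * (p.1.2 : ℝ) ^ (-(5 / 4 : ℝ))) * (p.2 : ℝ) ^ (-(29 / 20 : ℝ))) :=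
    hf.mul_of_nonneg hg (fun _ ↦ by positivity) (fun _ ↦ by positivity)
  exact Summable.of_norm_bounded (hfg.mul_left _) fun p ↦ norm_offDiagTerm_le_majorant hq hl hm hC p.1 p.2

/-- The `r`-section: for each `n`, `r ↦ offDiagTerm q l m n r` is summable.
[cite: KowalskiMichel2000, §2.4.2 p. 312 (23) — derivation] -/
theorem summable_offDiagTerm_left (hq : q.Prime) {l m : ℕ} (hl : 1 ≤ l) (hm : 1 ≤ m) (n : ℕ × ℕ) :
    Summable (fun r : ℕ ↦ offDiagTerm q l m n r) :=
  (summable_offDiagTerm hq hl hm).prod_factor n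

/-- The `n`-section: for each `r`, `n ↦ offDiagTerm q l m n r` is summable (so `offDiagLayer` is a genuine
sum). [cite: KowalskiMichel2000, §2.4.2 p. 312 (23) — derivation] -/
theorem summable_offDiagTerm_right (hq : q.Prime) {l m : ℕ} (hl : 1 ≤ l) (hm : 1 ≤ m) (r : ℕ) :
    Summable (fun n : ℕ × ℕ ↦ offDiagTerm q l m n r) :=
  (summable_offDiagTerm hq hl hm).prod_symm.prod_factor r

/-- **The layers are absolutely summable in `r`.** [cite: KowalskiMichel2000, §2.4.2 p. 312 (23) — derivation] -/
theorem summable_offDiagLayer (hq : q.Prime) {l m : ℕ} (hl : 1 ≤ l) (hm : 1 ≤ m) :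
    Summable (offDiagLayer q l m) :=
  (summable_offDiagTerm hq hl hm).prod_symm.prod

end Summit.Parity.GeneralizedHardyLittlewood.Theorems.BeyondDiagonalBeatsQuarter.PeterssonSplit
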